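import Summits.QuantumAdvantage.QuantumAdvantage.Theorems.LinnikCubicClassGroupsDegreeOnePrimesEscapeClassPNTOfDensity
import HarnessLib

/-!
# The additive class prime number theorem, X: relative error `ε` (equidistribution form)

Topic `Summits/QuantumAdvantage/QuantumAdvantage/Theorems`, cell B2b-1 (linnik-cubic), PART A, the
`stub_classPNTAdditive` slice of the crux `DegreeOnePrimesEscape` (stmt-QuantumAdvantage-11543), in
DEGREE-LOCAL form.  HONEST FRAMING: the value of this file is a THEOREM — not summit progress.

`classPNTAdditive_of_famDensity_eps`: the `ε`-version of `classPNTAdditive_of_famDensity` (file VII): for every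
`ε > 0` there is `c₁ = c₁(n, b, D, a, ε) > 0` such that every number field of degree `n > 1` obeying the
family density bound in `Q`-form satisfies, for every class `C` and every `x ≥ Q^{c₁}`,
`|π_C(x) − Li(x)/h| ≤ ε Li(x)/h`, or (with the at most one exceptional real zero `β₁ ∈ (1 − 1/(8 log Q), 1)`
of a real class group character `χ₁`) `|π_C(x) − (Li(x) − Re χ₁(C) Li(x^{β₁}))/h| ≤ ε Li(x)/h`.
Same proof as file VII with `η = ε/2` in `thetaClass_dichotomy` and the thresholds `e^{L/4} ≥ 1296 n/ε`,
`e^{L/4} ≥ 1344/ε`.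
-/

noncomputable section

open Complex Real MeasureTheory Set Filter Topology
open scoped NumberField nonZeroDivisors

namespace Summit.QuantumAdvantage.QuantumAdvantage.Theorems.DegreeOnePrimesEscape

open Literature.NumberTheory.LFunctions Literature.NumberTheory.LFunctions.NumberField
  Literature.NumberTheory.LFunctions.AbelianDensity

set_option maxHeartbeats 1600000 in
/-- **The additive class prime number theorem with relative error `ε`, for the number fields of one degree
`n > 1` obeying the family density bound in `Q`-form**: for every `ε > 0` there is `c₁ > 0` such that for
every such `K`, EITHER `|π_C(x) − Li(x)/h| ≤ ε Li(x)/h` for all classes `C` and all `x ≥ Q^{c₁}`, OR there are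
a real class group character `χ₁` and a real zero `β₁ ∈ (1 − 1/(8 log Q), 1)` of `L(s, χ₁)` with
`|π_C(x) − (Li(x) − Re χ₁(C) Li(x^{β₁}))/h| ≤ ε Li(x)/h` for all `C` and all `x ≥ Q^{c₁}` — i.e.
`π_C(x) = (Li(x) − θ₁ Re χ₁(C) Li(x^{β₁}))/h · (1 + o(1))`-type equidistribution with ADDITIVE `o(Li/h)`,
as `log x/log Q → ∞`, uniformly over the fields of degree `n`. -/
theorem classPNTAdditive_of_famDensity_eps (n : ℕ) (hn : 1 < n) {b D a : ℝ} (hb : 0 < b) (hD : 0 < D)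
    (ha : 1 ≤ a) {ε : ℝ} (hε : 0 < ε) :
    ∃ c₁ : ℝ, 0 < c₁ ∧ ∀ (K : Type) [Field K] [NumberField K], Module.finrank ℚ K = n →
      (∀ (T : ℝ), 1 ≤ T → ∀ u : AddChar (Additive (ClassGroup (𝓞 K))) ℂ → Finset ℂ,
        (∀ ψ, ∀ ρ ∈ u ψ, famF K ψ ρ = 0 ∧ 1 / 4 ≤ ρ.re ∧ ρ.re < 1 ∧ |ρ.im| ≤ T) →
        ∀ α : ℝ, α ≤ 1 →
          ∑ ψ, ∑ ρ ∈ u ψ with α ≤ ρ.re, (famMult K ψ ρ : ℝ) ≤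
            D * Real.exp (b * (a * Real.log (ThornerZaman.condQn K) + Real.log (T + 4))) ^ (1 - α)) →
      ((∀ (C : ClassGroup (𝓞 K)) (x : ℝ), ThornerZaman.condQn K ^ c₁ ≤ x →
          |(primeIdealClassCount K C x : ℝ) - offsetLogIntegral x / NumberField.classNumber K| ≤
            ε * offsetLogIntegral x / NumberField.classNumber K) ∨
        ∃ (χ₁ : ClassGroup (𝓞 K) →* ℂˣ) (β₁ : ℝ), χ₁ * χ₁ = 1 ∧
          1 - 1 / (8 * Real.log (ThornerZaman.condQn K)) < β₁ ∧ β₁ < 1 ∧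
          classGroupLFunction K χ₁ β₁ = 0 ∧
          ∀ (C : ClassGroup (𝓞 K)) (x : ℝ), ThornerZaman.condQn K ^ c₁ ≤ x →
            |(primeIdealClassCount K C x : ℝ) -
                (offsetLogIntegral x - ((χ₁ C : ℂ)).re * offsetLogIntegral (x ^ β₁)) /
                  NumberField.classNumber K| ≤
              ε * offsetLogIntegral x / NumberField.classNumber K) := by
  classical
  obtain ⟨a₂, c, ha₂1, hc, hcn, hθ⟩ := thetaClass_dichotomy n hn hb hD ha (by positivity : (0:ℝ) < ε / 2)
  set Λ₁ : ℝ := max (max 0 (4 * Real.log (1296 * n / ε))) (4 * Real.log (1344 / ε)) with hΛ₁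
  set c₁ : ℝ := max (2 * a₂ + 8) (max 32 Λ₁) with hc₁
  have hc₁a : 2 * a₂ + 8 ≤ c₁ := le_max_left _ _
  have hc₁32 : (32 : ℝ) ≤ c₁ := le_trans (le_max_left _ _) (le_max_right _ _)
  have hc₁Λ : Λ₁ ≤ c₁ := le_trans (le_max_right _ _) (le_max_right _ _)
  refine ⟨c₁, by linarith, fun K _ _ hKn hdens ↦ ?_⟩
  have hK : 1 < Module.finrank ℚ K := by rw [hKn]; exact hn
  set Q : ℝ := ThornerZaman.condQn K with hQ
  have hQ12 : (12 : ℝ) ≤ Q := ThornerZaman.twelve_le_condQn (K := K) hK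
  have hQ1 : (1 : ℝ) < Q := by linarith
  have hlog12 : (2 : ℝ) ≤ Real.log 12 := by
    rw [Real.le_log_iff_exp_le (by norm_num)]
    have := Real.exp_one_lt_d9
    have h : Real.exp 2 = Real.exp 1 * Real.exp 1 := by rw [← Real.exp_add]; norm_num
    rw [h]; nlinarith [Real.exp_pos (1:ℝ)]
  have hlogQ : 2 ≤ Real.log Q := hlog12.trans (Real.log_le_log (by norm_num) hQ12)
  set h : ℝ := (NumberField.classNumber K : ℝ) with hh
  have hh1 : 1 ≤ h := by rw [hh]; exact_mod_cast one_le_classNumber (K := K)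
  have hh0 : 0 < h := by linarith
  have hhQ : h ≤ Q ^ 4 := by
    have := ThornerZaman.classNumber_le_condQn_pow (K := K) hK; rw [← hQ] at this; exact this
  set y : ℝ := Q ^ a₂ with hy
  have hy8 : 8 ≤ y := by
    have : Q ^ (1 : ℝ) ≤ Q ^ a₂ := Real.rpow_le_rpow_of_exponent_le hQ1.le ha₂1
    rw [Real.rpow_one] at this; rw [hy]; linarith
  set B : ℝ := (n : ℝ) * (Real.log 4 + 4) with hBdef
  have hlog40 : 0 ≤ Real.log 4 := Real.log_nonneg (by norm_num)
  have hB0 : 0 ≤ B := by positivity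
  have hB6 : B ≤ 6 * n := by
    have hlog4 : Real.log 4 < 2 := by
      have : Real.log 4 = 2 * Real.log 2 := by
        rw [show (4:ℝ) = 2 ^ 2 by norm_num, Real.log_pow]; norm_num
      rw [this]; have := Real.log_two_lt_d9; linarith
    have hn0 : (0:ℝ) ≤ n := Nat.cast_nonneg _
    rw [hBdef]; nlinarith
  have hBt : ∀ t ∈ Set.Icc 2 y, chebyshevThetaIdeal K t ≤ B * t := by
    intro t ht
    have := chebyshevThetaIdeal_le_mul (K := K) (x := t) (by linarith [ht.1])
    rw [hKn] at this; rw [hBdef]; linarith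
  -- the final numerics at `x ≥ Q^{c₁}`
  have hnum : ∀ x : ℝ, Q ^ c₁ ≤ x → 256 ≤ x ∧ y ^ 2 ≤ x ∧ (∀ t, y ≤ t → Q ^ a₂ ≤ t) ∧
      (ε / 2) * (offsetLogIntegral x + 3) / h + 3 * (B + 3 / h) * y + 28 / h * Real.sqrt x ≤
        ε * offsetLogIntegral x / h := by
    intro x hx
    have hxQ : Q ≤ x := by
      have : Q ^ (1 : ℝ) ≤ Q ^ c₁ := Real.rpow_le_rpow_of_exponent_le hQ1.le (by linarith)
      rw [Real.rpow_one] at this; linarith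
    have hx1 : 1 < x := by linarith
    have hx0 : 0 < x := by linarith
    set L : ℝ := Real.log x with hL
    have hLQ : c₁ * Real.log Q ≤ L := by
      have := Real.log_le_log (by positivity) hx
      rwa [Real.log_rpow (by linarith)] at this
    have hL2c : 2 * c₁ ≤ L := by nlinarith
    have hL64 : 64 ≤ L := by nlinarith
    have hexpL : Real.exp L = x := by rw [hL, Real.exp_log hx0]
    have hx256 : 256 ≤ x := by
      rw [← hexpL]
      have : (256:ℝ) ≤ Real.exp 16 := by linarith [exp_sixteen_ge]
      exact this.trans (Real.exp_le_exp.2 (by linarith))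
    have hy2x : y ^ 2 ≤ x := by
      rw [hy, ← Real.rpow_natCast, ← Real.rpow_mul (le_of_lt (lt_trans zero_lt_one hQ1))]
      refine le_trans (Real.rpow_le_rpow_of_exponent_le hQ1.le ?_) hx
      push_cast; linarith
    refine ⟨hx256, hy2x, fun t ht ↦ by rw [← hy]; exact ht, ?_⟩
    -- `Li(x) ≥ x/(2L)` and the three small terms
    have hLi := div_two_mul_log_le_offsetLogIntegral hx256
    rw [← hL] at hLi
    have hL0 : 0 < L := by linarith
    have hL4 := le_four_mul_exp_div_four L
    have he16 : (43008 : ℝ) ≤ Real.exp (L / 4) := exp_sixteen_ge.trans (Real.exp_le_exp.2 (by linarith))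
    have hsqx : Real.sqrt x = Real.exp (L / 2) := by
      rw [Real.sqrt_eq_rpow, Real.rpow_def_of_pos hx0, ← hL]; ring_nf
    have hx4 : x = Real.exp (L / 4) * Real.exp (L / 4) * Real.exp (L / 2) := by
      rw [← Real.exp_add, ← Real.exp_add, ← hexpL]; ring_nf
    have hE4 : 0 < Real.exp (L / 4) := Real.exp_pos _
    have hE2 : 0 < Real.exp (L / 2) := Real.exp_pos _
    have hE2' : Real.exp (L / 2) = Real.exp (L / 4) * Real.exp (L / 4) := by rw [← Real.exp_add]; ring_nf
    -- (i) `3 · 6L ≤ x`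
    have hi : 3 * (6 * L) ≤ x := by
      have h1 : 3 * (6 * L) ≤ 72 * Real.exp (L / 4) := by linarith
      have hE21 : 1 ≤ Real.exp (L / 2) := Real.one_le_exp (by linarith)
      have h2 : (72 : ℝ) ≤ Real.exp (L / 4) * Real.exp (L / 2) := by nlinarith
      have h3 : 72 * Real.exp (L / 4) ≤ Real.exp (L / 4) * (Real.exp (L / 4) * Real.exp (L / 2)) :=
        by nlinarith
      rw [hx4]; linarith
    -- (ii) `(6 (B h + 3) y / ε) · 6L ≤ x`
    have hii : 6 * (B * h + 3) * y / ε * (6 * L) ≤ x := by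
      have hya : Q ^ a₂ * Q ^ 4 ≤ Real.exp (L / 2) := by
        rw [← Real.rpow_natCast, ← Real.rpow_add (by linarith), Real.rpow_def_of_pos (by linarith)]
        refine Real.exp_le_exp.2 ?_
        push_cast; nlinarith
      have hBh : B * h + 3 ≤ 9 * n * Q ^ 4 := by
        have hn1 : (1:ℝ) ≤ n := by exact_mod_cast (le_of_lt hn)
        have hQ4 : 1 ≤ Q ^ 4 := one_le_pow₀ hQ1.le
        nlinarith [mul_le_mul hB6 hhQ hh0.le (by positivity), mul_nonneg (Nat.cast_nonneg n) (le_of_lt hh0)]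
      have hnL : 1296 * (n : ℝ) / ε ≤ Real.exp (L / 4) := by
        refine le_exp_of_log_le (by positivity) ?_
        have : 4 * Real.log (1296 * n / ε) ≤ Λ₁ := le_trans (le_max_right _ _) (le_max_left _ _)
        nlinarith
      have hy0 : 0 ≤ y := by rw [hy]; positivity
      calc 6 * (B * h + 3) * y / ε * (6 * L) ≤ 6 * (9 * n * Q ^ 4) * y / ε * (6 * (4 * Real.exp (L / 4))) := by
            have h0 : 0 ≤ 6 * (B * h + 3) * y / ε := by positivity
            have h1 : 6 * (B * h + 3) * y / ε ≤ 6 * (9 * n * Q ^ 4) * y / ε := by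
              apply div_le_div_of_nonneg_right _ hε.le; nlinarith
            exact mul_le_mul h1 (by linarith) (by positivity) (by positivity)
        _ = (1296 * n / ε) * (Q ^ a₂ * Q ^ 4) * Real.exp (L / 4) := by rw [hy]; ring
        _ ≤ Real.exp (L / 4) * Real.exp (L / 2) * Real.exp (L / 4) := by
            gcongr
        _ = x := by rw [hx4]; ring
    -- (iii) `(56 √x / ε) · 6L ≤ x`
    have hiii : 56 * Real.sqrt x / ε * (6 * L) ≤ x := by
      have heL : 1344 / ε ≤ Real.exp (L / 4) := by
        refine le_exp_of_log_le (by positivity) ?_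
        have : 4 * Real.log (1344 / ε) ≤ Λ₁ := le_max_right _ _
        nlinarith
      rw [hsqx, hx4]
      calc 56 * Real.exp (L / 2) / ε * (6 * L) ≤ 56 * Real.exp (L / 2) / ε * (6 * (4 * Real.exp (L / 4))) := by
            have h0 : 0 ≤ 56 * Real.exp (L / 2) / ε := by positivity
            nlinarith [hE2]
        _ = (1344 / ε) * Real.exp (L / 2) * Real.exp (L / 4) := by ring
        _ ≤ Real.exp (L / 4) * Real.exp (L / 2) * Real.exp (L / 4) := by gcongr
        _ = Real.exp (L / 4) * Real.exp (L / 4) * Real.exp (L / 2) := by ring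
    -- combine: `3 + (6(Bh+3)y + 56√x)/ε ≤ x/(2L) ≤ Li`
    have hsum : 3 + 6 * (B * h + 3) * y / ε + 56 * Real.sqrt x / ε ≤ x / (2 * L) := by
      rw [le_div_iff₀ (by positivity)]; nlinarith
    have hkey : 3 + 6 * (B * h + 3) * y / ε + 56 * Real.sqrt x / ε ≤ offsetLogIntegral x := hsum.trans hLi
    have hkey' : 3 * ε / 2 + 3 * (B * h + 3) * y + 28 * Real.sqrt x ≤ ε / 2 * offsetLogIntegral x := by
      have := mul_le_mul_of_nonneg_left hkey (by positivity : (0:ℝ) ≤ ε / 2)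
      have e : ε / 2 * (3 + 6 * (B * h + 3) * y / ε + 56 * Real.sqrt x / ε) =
          3 * ε / 2 + 3 * (B * h + 3) * y + 28 * Real.sqrt x := by field_simp; ring
      linarith
    -- divide by `h`
    have e1 : (ε / 2) * (offsetLogIntegral x + 3) / h + 3 * (B + 3 / h) * y + 28 / h * Real.sqrt x =
        ((ε / 2) * offsetLogIntegral x + (3 * ε / 2 + 3 * (B * h + 3) * y + 28 * Real.sqrt x)) / h := by
      field_simp; ring
    rw [e1, div_le_div_iff_of_pos_right hh0]
    nlinarith
  rcases hθ K hKn hdens with hgood | ⟨χ₁, β₁, hreal, hβlow, hβ1, hLzero, hexc⟩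
  · left
    intro C x hx
    obtain ⟨hx256, hy2x, hyt, hfin⟩ := hnum x hx
    have hθC : ∀ t ∈ Set.Icc y x, |chebyshevThetaIdealClass K C t -
        (t - 0 * t ^ (1:ℝ) / 1) / NumberField.classNumber K| ≤ ε / 2 * t / NumberField.classNumber K := by
      intro t ht
      have := hgood t (hyt t ht.1) C
      simpa using this
    have key := abs_primeIdealClassCount_sub_main_le C (θ₁ := 0) (β := 1) (by simp) (by norm_num) le_rfl
      hy8 hx256 hy2x (by positivity) hB0 hθC hBt
    simp only [zero_mul, sub_zero] at key
    exact key.trans hfin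
  · right
    have hβQ : 1 - 1 / (8 * Real.log (ThornerZaman.condQn K)) < β₁ := by
      have := excRegion_le_inv_eight_log_condQn K hK hc.le (by rw [hKn]; exact hcn)
      linarith
    refine ⟨χ₁, β₁, hreal, hβQ, hβ1, hLzero, fun C x hx ↦ ?_⟩
    obtain ⟨hx256, hy2x, hyt, hfin⟩ := hnum x hx
    have hβhalf : 1 / 2 < β₁ := by
      have h16 : 1 / (8 * Real.log (ThornerZaman.condQn K)) ≤ 1 / 16 := by
        rw [← hQ]; rw [div_le_div_iff₀ (by positivity) (by norm_num)]; nlinarith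
      linarith
    have hθabs : |((χ₁ C : ℂ)).re| ≤ 1 := abs_re_classGroupChar_apply_le hreal C
    have hθC : ∀ t ∈ Set.Icc y x, |chebyshevThetaIdealClass K C t -
        (t - ((χ₁ C : ℂ)).re * t ^ β₁ / β₁) / NumberField.classNumber K| ≤
          ε / 2 * t / NumberField.classNumber K :=
      fun t ht ↦ hexc t (hyt t ht.1) C
    have key := abs_primeIdealClassCount_sub_main_le C hθabs hβhalf hβ1.le hy8 hx256 hy2x (by positivity)
      hB0 hθC hBt
    exact key.trans hfin

end Summit.QuantumAdvantage.QuantumAdvantage.Theorems.DegreeOnePrimesEscape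

end
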